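import Mathlib
import HarnessLib
import Summits.Ventures.LatticeQCDFlow.Scoring.SimultaneousAgreementTwoSigma

/-!
# THE STUDENT-RATIO PROBABILITY AS A SCALE MIXTURE OVER THE OTHER COORDINATES, AND THE STRICT
# CONCAVITY OF `x ↦ N(0,1)([−q√x, q√x])`

HONEST FRAMING: exact (Metropolis-corrected) sampling algorithms for lattice gauge theory;
figures of merit are autocorrelation/cost numbers at stated couplings and volumes; no
continuum-physics claim.

Venture `LatticeQCDFlow` (cell pub-lqcd), topic `Scoring`; FANOUT row 4 (`s0-u1-b`, GEN-33).
NEW WORK of the cell (classical; not in Mathlib), no definition, nothing cited as a fact.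

WHY (row 4).  The limiting coverage of the cell's error bars built from a FIXED number `R = n + 1`
of batches / replicas / independent runs is the Student-ratio probability
`N(0,1)^{⊗(n+1)}{z | |z₀| ≤ q √((Σ_{j=1}^{n} z_j²)/n)}` (row 13 GEN-24
`Exactness/NCMCGeneralSpaceReplicaTStatisticStudent`; row 4 GEN-32's fixed-count files print the
same functional in the form `{a ḡ² ≤ q² s²(g)}`).  This file supplies the two inputs of its
monotonicity in `R` (`Scoring/GaussianStudentCountMonotone.lean`): (§1) the acceptance mass
`ψ_q(x) = N(0,1)([−q√x, q√x])`, read as a function of the VARIANCE-like argument `x`, is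
continuous, bounded by `1`, differentiable on `(0, ∞)` with derivative `q φ(q√x)/√x`, and STRICTLY
CONCAVE on `[0, ∞)` for `q > 0` (that derivative strictly decreases: `φ` decreases on `[0, ∞)` and
`1/√x` strictly decreases; `StrictAntiOn.strictConcaveOn_of_deriv`); (§2) integrating out the
numerator coordinate first (`measurePreserving_piFinSuccAbove`, `Measure.prod_apply_symm`), the
Student-ratio probability with `n + 1` coordinates is the `N(0,1)^{⊗n}`-expectation of
`ψ_q((Σ_j w_j²)/n)` — a function of the MEAN of `n` i.i.d. squared standard normals; (§3) the square
of a standard normal is non-degenerate (`N(0,1){x² ≤ 1/4} > 0`, `N(0,1){1 ≤ x²} > 0`).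
Row 13's `…ReplicaTStatisticUndercoverage` (concavity of `x ↦ N(0,1)([−x, x])` itself and a
conditioning identity on the full product space) is neither imported nor restated: the statements
here concern the composite `x ↦ N(0,1)([−q√x, q√x])` and the marginal over the other coordinates.

## Content

* `gaussianReal_real_Icc_sqrt_eq_two_mul_primitive` — `ψ_q(x) = 2 ∫₀^{q√x} φ` (`q ≥ 0`);
  `continuous_gaussianReal_real_Icc_sqrt`, `abs_gaussianReal_real_Icc_sqrt_le_one`.
* `hasDerivAt_gaussianReal_real_Icc_sqrt` — `ψ_q'(x) = q φ(q√x)/√x` (`x > 0`);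
  `strictAntiOn_deriv_gaussianReal_real_Icc_sqrt` (`q > 0`).
* **`strictConcaveOn_gaussianReal_real_Icc_sqrt`** (`q > 0`), `concaveOn_gaussianReal_real_Icc_sqrt`
  (`q ≥ 0`) — on `[0, ∞)`.
* **`pi_gaussianReal_studentRatio_real_eq_integral`** — for every `q`, `n`:
  `N(0,1)^{⊗(n+1)}{|z₀| ≤ q √((Σ_{j<n} z_{j+1}²)/n)} = ∫ ψ_q((Σ_j w_j²)/n) dN(0,1)^{⊗n}(w)`.
* `gaussianReal_sq_nondegenerate` — `∃ a < b` with `N(0,1){x² ≤ a} > 0 < N(0,1){b ≤ x²}`.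

Depends on row 4's BUILT `Scoring/SimultaneousAgreementTwoSigma` (`N(0,1)([−z, z]) = 2 ∫₀^z φ`,
the primitive's derivative and continuity, `φ(x) = (√(2π))⁻¹e^{−x²/2}`) and Mathlib.  [ours]
throughout.
-/

open MeasureTheory ProbabilityTheory Filter Topology Finset

namespace Summit.Ventures.LatticeQCDFlow.Scoring

open Set

/-! ## §1 The acceptance mass `ψ_q(x) = N(0,1)([−q√x, q√x])` is continuous, bounded and
## STRICTLY CONCAVE on `[0, ∞)` -/

section Psi

/-- `ψ_q(x) = N(0,1)([−q√x, q√x]) = 2 ∫₀^{q√x} φ` for `q ≥ 0` (every `x`). [ours] -/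
theorem gaussianReal_real_Icc_sqrt_eq_two_mul_primitive {q : ℝ} (hq : 0 ≤ q) (x : ℝ) :
    (gaussianReal 0 1).real (Icc (-(q * Real.sqrt x)) (q * Real.sqrt x))
      = 2 * ∫ t in (0 : ℝ)..(q * Real.sqrt x), gaussianPDFReal 0 1 t :=
  CardConsistency.gaussianReal_real_Icc_eq_two_mul_primitive (mul_nonneg hq (Real.sqrt_nonneg x))

/-- `ψ_q` is continuous on `ℝ` (`q ≥ 0`). [ours] -/
theorem continuous_gaussianReal_real_Icc_sqrt {q : ℝ} (hq : 0 ≤ q) :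
    Continuous fun x : ℝ => (gaussianReal 0 1).real (Icc (-(q * Real.sqrt x)) (q * Real.sqrt x)) := by
  simp_rw [gaussianReal_real_Icc_sqrt_eq_two_mul_primitive hq]
  exact continuous_const.mul (CardConsistency.continuous_primitive_gaussianPDFReal.comp
    (continuous_const.mul Real.continuous_sqrt))

/-- `0 ≤ ψ_q ≤ 1`, so `|ψ_q| ≤ 1`. [ours] -/
theorem abs_gaussianReal_real_Icc_sqrt_le_one (q x : ℝ) :
    |(gaussianReal 0 1).real (Icc (-(q * Real.sqrt x)) (q * Real.sqrt x))| ≤ 1 := by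
  rw [abs_of_nonneg measureReal_nonneg]
  exact measureReal_le_one

/-- The derivative of `ψ_q` at `x > 0` is `q φ(q√x)/√x` (`q ≥ 0`). [ours] -/
theorem hasDerivAt_gaussianReal_real_Icc_sqrt {q : ℝ} (hq : 0 ≤ q) {x : ℝ} (hx : 0 < x) :
    HasDerivAt (fun x : ℝ => (gaussianReal 0 1).real (Icc (-(q * Real.sqrt x)) (q * Real.sqrt x)))
      (q * gaussianPDFReal 0 1 (q * Real.sqrt x) / Real.sqrt x) x := by
  have hfun : (fun x : ℝ => (gaussianReal 0 1).real (Icc (-(q * Real.sqrt x)) (q * Real.sqrt x)))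
      = fun x => 2 * ∫ t in (0 : ℝ)..(q * Real.sqrt x), gaussianPDFReal 0 1 t :=
    funext (gaussianReal_real_Icc_sqrt_eq_two_mul_primitive hq)
  rw [hfun]
  have h1 : HasDerivAt (fun y : ℝ => q * Real.sqrt y) (q * (1 / (2 * Real.sqrt x))) x :=
    (Real.hasDerivAt_sqrt hx.ne').const_mul q
  have h2 : HasDerivAt ((fun u : ℝ => ∫ t in (0 : ℝ)..u, gaussianPDFReal 0 1 t)
        ∘ fun y : ℝ => q * Real.sqrt y)
      (gaussianPDFReal 0 1 (q * Real.sqrt x) * (q * (1 / (2 * Real.sqrt x)))) x :=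
    (CardConsistency.hasDerivAt_primitive_gaussianPDFReal (q * Real.sqrt x)).comp x h1
  have h3 : HasDerivAt (fun y : ℝ => 2 * ∫ t in (0 : ℝ)..(q * Real.sqrt y), gaussianPDFReal 0 1 t)
      (2 * (gaussianPDFReal 0 1 (q * Real.sqrt x) * (q * (1 / (2 * Real.sqrt x))))) x :=
    h2.const_mul 2
  refine h3.congr_deriv ?_
  ring

/-- On `(0, ∞)` the derivative `x ↦ q φ(q√x)/√x` of `ψ_q` is STRICTLY decreasing (`q > 0`):
`φ` decreases on `[0, ∞)` and `1/√x` strictly decreases. [ours] -/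
theorem strictAntiOn_deriv_gaussianReal_real_Icc_sqrt {q : ℝ} (hq : 0 < q) :
    StrictAntiOn (deriv fun x : ℝ =>
        (gaussianReal 0 1).real (Icc (-(q * Real.sqrt x)) (q * Real.sqrt x))) (Ioi 0) := by
  intro x hx y hy hxy
  rw [(hasDerivAt_gaussianReal_real_Icc_sqrt hq.le hx).deriv,
    (hasDerivAt_gaussianReal_real_Icc_sqrt hq.le hy).deriv]
  have hsx : 0 < Real.sqrt x := Real.sqrt_pos.2 hx
  have hsy : 0 < Real.sqrt y := Real.sqrt_pos.2 hy
  have hsxy : Real.sqrt x < Real.sqrt y := Real.sqrt_lt_sqrt hx.le hxy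
  have hpdf : gaussianPDFReal 0 1 (q * Real.sqrt y) ≤ gaussianPDFReal 0 1 (q * Real.sqrt x) := by
    rw [CardConsistency.gaussianPDFReal_std_eq, CardConsistency.gaussianPDFReal_std_eq]
    refine mul_le_mul_of_nonneg_left (Real.exp_le_exp.2 ?_) (by positivity)
    have : (q * Real.sqrt x) ^ 2 ≤ (q * Real.sqrt y) ^ 2 := by
      rw [mul_pow, mul_pow, Real.sq_sqrt hx.le, Real.sq_sqrt hy.le]
      exact mul_le_mul_of_nonneg_left hxy.le (sq_nonneg q)
    linarith
  have hnum : 0 < q * gaussianPDFReal 0 1 (q * Real.sqrt x) :=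
    mul_pos hq (gaussianPDFReal_pos _ _ _ one_ne_zero)
  calc q * gaussianPDFReal 0 1 (q * Real.sqrt y) / Real.sqrt y
      ≤ q * gaussianPDFReal 0 1 (q * Real.sqrt x) / Real.sqrt y :=
        div_le_div_of_nonneg_right (mul_le_mul_of_nonneg_left hpdf hq.le) hsy.le
    _ < q * gaussianPDFReal 0 1 (q * Real.sqrt x) / Real.sqrt x :=
        div_lt_div_of_pos_left hnum hsx hsxy

/-- **`ψ_q` IS STRICTLY CONCAVE ON `[0, ∞)`** for `q > 0`. [ours] -/
theorem strictConcaveOn_gaussianReal_real_Icc_sqrt {q : ℝ} (hq : 0 < q) :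
    StrictConcaveOn ℝ (Ici 0) fun x : ℝ =>
      (gaussianReal 0 1).real (Icc (-(q * Real.sqrt x)) (q * Real.sqrt x)) := by
  refine StrictAntiOn.strictConcaveOn_of_deriv (convex_Ici 0)
    (continuous_gaussianReal_real_Icc_sqrt hq.le).continuousOn ?_
  rw [interior_Ici]
  exact strictAntiOn_deriv_gaussianReal_real_Icc_sqrt hq

/-- `ψ_q` is concave on `[0, ∞)` for `q ≥ 0` (constant `0` when `q = 0`). [ours] -/
theorem concaveOn_gaussianReal_real_Icc_sqrt {q : ℝ} (hq : 0 ≤ q) :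
    ConcaveOn ℝ (Ici 0) fun x : ℝ =>
      (gaussianReal 0 1).real (Icc (-(q * Real.sqrt x)) (q * Real.sqrt x)) := by
  rcases hq.eq_or_lt with h | h
  · subst h
    simp only [zero_mul, neg_zero]
    exact concaveOn_const _ (convex_Ici 0)
  · exact (strictConcaveOn_gaussianReal_real_Icc_sqrt h).concaveOn

end Psi

/-! ## §2 Conditioning on the other coordinates: the Student-ratio probability with `n + 1`
## coordinates is `E ψ_q(mean of n squared standard normals)` -/

section Representation

/-- **Scale-mixture representation**: for every `q` and `n`,
`N(0,1)^{⊗(n+1)}{z | |z₀| ≤ q √((Σ_{j<n} z_{j+1}²)/n)} = ∫ ψ_q((Σ_j w_j²)/n) dN(0,1)^{⊗n}(w)`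
(split off coordinate `0` with `measurePreserving_piFinSuccAbove`, integrate it out first). [ours] -/
theorem pi_gaussianReal_studentRatio_real_eq_integral (q : ℝ) (n : ℕ) :
    ((Measure.pi fun _ : Fin (n + 1) => gaussianReal 0 1)
        {z : Fin (n + 1) → ℝ | |z 0| ≤ q * Real.sqrt ((∑ j : Fin n, z j.succ ^ 2) / (n : ℝ))}).toReal
      = ∫ w, (gaussianReal 0 1).real
          (Icc (-(q * Real.sqrt ((∑ j, w j ^ 2) / (n : ℝ)))) (q * Real.sqrt ((∑ j, w j ^ 2) / (n : ℝ))))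
          ∂(Measure.pi fun _ : Fin n => gaussianReal 0 1) := by
  set γ : Measure ℝ := gaussianReal 0 1 with hγ
  set P := Measure.pi fun _ : Fin (n + 1) => γ with hP
  set Q := Measure.pi fun _ : Fin n => γ with hQ
  set m : (Fin n → ℝ) → ℝ := fun w => (∑ j, w j ^ 2) / (n : ℝ) with hm
  have hm_meas : Measurable m :=
    (Finset.measurable_sum _ fun j _ => (measurable_pi_apply j).pow_const 2).div_const _
  set B : Set (ℝ × (Fin n → ℝ)) := {p | |p.1| ≤ q * Real.sqrt (m p.2)} with hB
  have hBm : MeasurableSet B :=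
    measurableSet_le (measurable_fst.abs) (measurable_const.mul (hm_meas.comp measurable_snd).sqrt)
  have hmp := measurePreserving_piFinSuccAbove (fun _ : Fin (n + 1) => γ) 0
  -- the event is the preimage of `B` under the splitting equivalence
  have hA : {z : Fin (n + 1) → ℝ | |z 0| ≤ q * Real.sqrt ((∑ j : Fin n, z j.succ ^ 2) / (n : ℝ))}
      = MeasurableEquiv.piFinSuccAbove (fun _ : Fin (n + 1) => ℝ) 0 ⁻¹' B := by
    ext z
    simp only [hB, hm, Set.mem_setOf_eq, Set.mem_preimage, MeasurableEquiv.piFinSuccAbove_apply,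
      Fin.insertNthEquiv, Equiv.coe_fn_symm_mk, Fin.removeNth_zero, Fin.tail]
  rw [hA, ← Measure.map_apply (MeasurableEquiv.measurable _) hBm, hmp.map_eq,
    Measure.prod_apply_symm hBm]
  -- the sections in the first coordinate are the symmetric intervals
  have hsec : ∀ w : Fin n → ℝ, (fun x : ℝ => (x, w)) ⁻¹' B
      = Icc (-(q * Real.sqrt (m w))) (q * Real.sqrt (m w)) := fun w => by
    ext x; simp [hB, abs_le]
  have hmeas : Measurable fun w : Fin n → ℝ => γ ((fun x : ℝ => (x, w)) ⁻¹' B) :=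
    measurable_measure_prodMk_right hBm
  rw [← integral_toReal hmeas.aemeasurable (ae_of_all _ fun w => measure_lt_top _ _)]
  refine integral_congr_ae (ae_of_all _ fun w => ?_)
  simp only [hsec w, measureReal_def]
  rfl

end Representation

/-! ## §3 The square of a standard normal is non-degenerate -/

section Nondegenerate

/-- The square of a standard normal is non-degenerate in the sense of
`Scoring/SampleMeanConvexOrder` (`pi_integral_strictConcave_mean_strictMono`): `N(0,1){x² ≤ 1/4} > 0`
and `N(0,1){1 ≤ x²} > 0`. [ours] -/
theorem gaussianReal_sq_nondegenerate :
    ∃ a b : ℝ, a < b ∧ 0 < (gaussianReal 0 1) {x : ℝ | x ^ 2 ≤ a}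
      ∧ 0 < (gaussianReal 0 1) {x : ℝ | b ≤ x ^ 2} := by
  haveI : (gaussianReal (0 : ℝ) 1).IsOpenPosMeasure :=
    (gaussianReal_absolutelyContinuous' 0 one_ne_zero).isOpenPosMeasure
  refine ⟨1 / 4, 1, by norm_num, ?_, ?_⟩
  · refine lt_of_lt_of_le (isOpen_Ioo.measure_pos (gaussianReal 0 1)
      (nonempty_Ioo.2 (by norm_num : (-(1 / 2) : ℝ) < 1 / 2))) (measure_mono fun x hx => ?_)
    simp only [Set.mem_Ioo] at hx
    show x ^ 2 ≤ 1 / 4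
    nlinarith [hx.1, hx.2]
  · refine lt_of_lt_of_le (isOpen_Ioi.measure_pos (gaussianReal 0 1)
      (nonempty_Ioi (a := (1 : ℝ)))) (measure_mono fun x hx => ?_)
    simp only [Set.mem_Ioi] at hx
    show (1 : ℝ) ≤ x ^ 2
    nlinarith

end Nondegenerate

end Summit.Ventures.LatticeQCDFlow.Scoring
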